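import Mathlib
import Summits.QuantumAdvantage.QuantumAdvantage.Theses.MobiusLadder
import Summits.QuantumAdvantage.QuantumAdvantage.Theorems.MobiusLadderDigitPolyUniformityLiouvilleAutomatic
import Summits.QuantumAdvantage.QuantumAdvantage.Theorems.MobiusLadderDigitPolyUniformityAutomaticDyadic
import Summits.QuantumAdvantage.QuantumAdvantage.Theorems.MobiusLadderDigitPolyUniformityBlockAdditiveAutomatic
import Summits.QuantumAdvantage.QuantumAdvantage.Theorems.MobiusLadderDigitPolyUniformityDigitWeightAutomatic
import Summits.QuantumAdvantage.QuantumAdvantage.Theorems.MobiusLadderDigitPolyUniformityEsymmIndicator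
import Summits.QuantumAdvantage.QuantumAdvantage.Theorems.MobiusLadderDigitPolyUniformityChooseModTwoPeriodic
import Literature.RingTheory.MvPolynomial.IteratedDerivations

/-!
# Crux `DigitPolyUniformity` (stmt-QuantumAdvantage-1392): the AUTOMATIC digital phases,
# modulo Müllner 2017

The crux `Summit.QuantumAdvantage.QuantumAdvantage.Theses.MobiusLadder.DigitPolyUniformity` asks,
for every `A` and `ε > 0`, eventually in `n`, `|Σ_{N<2ⁿ} λ(N)(−1)^{P(bits N)}| ≤ ε2ⁿ` for EVERY
`P ∈ 𝔽₂[x_0..x_{n−1}]` of total degree `≤ (log₂ n)^A`. All sub-classes of `P` that the tree settles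
unconditionally so far (`…KnownClasses`, `…AffineProducts`, `…Sparse`: degree `≤ 1`, `≤ (log₂n)^A`
variables, `≤ n^c` affine products, `n^c`-sparse, Walsh spectral norm `≤ ε2^{n^c}`) are
SPECTRAL-NORM classes: they contain no bent-type phase. The first bent-type digital phases known
in print to be `λ`-uniform are the AUTOMATIC ones — the Rudin–Shapiro phase `Σ_i x_i x_{i+1}`
(rank `⌊n/2⌋`, flat Walsh spectrum), every BLOCK-ADDITIVE form `Σ_i q(x_i, …, x_{i+L−1})`, and every
phase that is a function of the binary digit sum modulo a fixed `m` (all FIXED symmetric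
polynomials, e.g. the full-rank quadratic `Σ_{i<j} x_i x_j = bit₁(s₂(N))`) — by C. Müllner,
*Automatic sequences fulfill the Sarnak conjecture*, Duke Math. J. 166 (2017), Thm. 1.2, which the
tree holds as the named fact `Literature.NumberTheory.LFunctions.mullner_moebius_automatic`
(`Literature/NumberTheory/LFunctions/MoebiusAutomatic.lean`; partially discharged there:
`mullner_moebius_automatic_holds_of : mullner2017_thm44 → …`).

This file states these classes in exactly the crux's vocabulary, CONDITIONALLY on that one named
fact (hypothesis `hM`), composing the six stubs of line Sketch landed by seat c3:
`liouville_automatic_of_mullner` (the Liouville variant of Müllner's theorem, `λ = 𝟙_□ ⋆ μ`),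
`digitPolyUniformity_automatic_of_liouville` (dyadic form), `isAutomaticSeq_of_blockAdditive`,
`isAutomaticSeq_of_digitWeight`, `eval_esymm_indicator`, `choose_mod_two_periodic`.

* `digitPolyUniformity_automatic` — every REAL weight whose complexification is `2`-automatic;
* `digitPolyUniformity_blockAdditive` — every `P` whose cube values are the block-additive
  function `Σ_{i<n} q(x_i, …, x_{i+L−1})` (`x_t = 0` for `t ≥ n`) of a fixed local rule
  `q ∈ 𝔽₂[y_0..y_{L−1}]` with `q(0) = 0`; `exists_blockPoly` shows such `P` exist with
  `deg P ≤ deg q` (so they lie in the crux's range for all large `n`), and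
  `digitPolyUniformity_rudinShapiro` is the instance `q = y_0 y_1`;
* `digitPolyUniformity_digitSum` — every weight `g(s₂(N) mod m)`, `m ≥ 1` fixed;
* `digitPolyUniformity_esymm` — the elementary symmetric polynomials `e_k(x_0, …, x_{n−1})`,
  `k` fixed (`e_k(bits N) = C(s₂(N), k)`, a function of `s₂(N) mod 2^k` by Lucas).

What remains open after this file and the spectral classes is therefore the regime of phases that
couple digit positions in an `n`-DEPENDENT, non-automatic way — the mirror forms `Σ_i x_i x_{n−1−i}`
of the sibling crux `QuadraticDigitPhases` (stmt-1391) and generic polylog-degree phases.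
-/

set_option linter.dupNamespace false -- D-0017: single-problem summit ⇒ `QuantumAdvantage.QuantumAdvantage` by design

noncomputable section

namespace Summit.QuantumAdvantage.QuantumAdvantage.Theorems.MobiusLadder

open Filter Finset
open Literature.NumberTheory.LFunctions (IsAutomaticSeq mullner_moebius_automatic)

/-! ### Every real `2`-automatic weight -/

/-- **The crux for automatic weights, modulo Müllner 2017.** Assuming the named fact
`mullner_moebius_automatic` (Müllner 2017, Thm. 1.2: automatic sequences are orthogonal to `μ`),
for every real weight `φ` whose complexification is `2`-automatic and every `ε > 0`, eventually in
`n`, `|Σ_{N<2ⁿ} λ(N) φ(N)| ≤ ε 2ⁿ`. Composition of the stubs `liouville_automatic_of_mullner`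
(`μ ⇒ λ`) and `digitPolyUniformity_automatic_of_liouville` (dyadic form).
[cite: Mullner2017, Thm. 1.2] -/
theorem digitPolyUniformity_automatic :
    Literature.NumberTheory.LFunctions.mullner_moebius_automatic → ∀ φ : ℕ → ℝ, Literature.NumberTheory.LFunctions.IsAutomaticSeq 2 (fun N => (φ N : ℂ)) → ∀ ε : ℝ, 0 < ε → ∀ᶠ n : ℕ in Filter.atTop, |∑ N ∈ Finset.range (2 ^ n), ((ArithmeticFunction.liouville N : ℤ) : ℝ) * φ N| ≤ ε * (2 : ℝ) ^ n :=
  fun hM φ hφ =>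
    digitPolyUniformity_automatic_of_liouville (liouville_automatic_of_mullner hM 2 le_rfl) φ hφ

namespace AutomaticClasses

/-! ### Windows above the top digit -/

/-- A digit window starting at or above the bit length reads `false`. [folklore] -/
theorem testBit_window_eq_false {N M i : ℕ} (hN : N < 2 ^ M) (hi : M ≤ i) {L : ℕ} (j : Fin L) :
    N.testBit (i + j) = false :=
  Nat.testBit_eq_false_of_lt (lt_of_lt_of_le hN (Nat.pow_le_pow_right two_pos (by omega)))

/-- For a local rule `Q` with `Q(0,…,0) = 0`, the sum of `Q` over the window positions `i < M` does
not depend on `M` once `N < 2^M`. [folklore] -/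
theorem sum_window_eq_of_lt {L : ℕ} (Q : (Fin L → Bool) → ZMod 2) (hQ : Q (fun _ => false) = 0)
    {N M M' : ℕ} (hM : N < 2 ^ M) (hM' : N < 2 ^ M') :
    ∑ i ∈ range M, Q (fun j : Fin L => N.testBit (i + j)) =
      ∑ i ∈ range M', Q (fun j : Fin L => N.testBit (i + j)) := by
  wlog hle : M ≤ M' generalizing M M'
  · exact (this hM' hM (le_of_not_ge hle)).symm
  rw [← Finset.sum_range_add_sum_Ico _ hle]
  conv_lhs => rw [← add_zero (∑ i ∈ range M, Q (fun j : Fin L => N.testBit (i + j)))]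
  congr 1
  refine (Finset.sum_eq_zero fun i hi => ?_).symm
  rw [Finset.mem_Ico] at hi
  have hw : (fun j : Fin L => N.testBit (i + j)) = fun _ => false :=
    funext fun j => testBit_window_eq_false hM hi.1 j
  rw [hw, hQ]

/-- The number of set bits among the positions `< M` does not depend on `M` once `N < 2^M`.
[folklore] -/
theorem card_filter_testBit_eq_of_lt {N M M' : ℕ} (hM : N < 2 ^ M) (hM' : N < 2 ^ M') :
    ((range M).filter fun i => N.testBit i).card = ((range M').filter fun i => N.testBit i).card := by
  wlog hle : M ≤ M' generalizing M M'
  · exact (this hM' hM (le_of_not_ge hle)).symm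
  congr 1
  ext i
  simp only [Finset.mem_filter, Finset.mem_range]
  constructor
  · rintro ⟨hi, hb⟩
    exact ⟨lt_of_lt_of_le hi hle, hb⟩
  · rintro ⟨-, hb⟩
    refine ⟨?_, hb⟩
    by_contra hge
    have h0 : N.testBit i = false :=
      Nat.testBit_eq_false_of_lt (lt_of_lt_of_le hM (Nat.pow_le_pow_right two_pos (by omega)))
    rw [h0] at hb
    exact Bool.false_ne_true hb

/-- The set bits among the positions `< n`, counted on `Fin n` or on `range n`. [folklore] -/
theorem card_univ_filter_testBit (n N : ℕ) :
    (Finset.univ.filter fun i : Fin n => N.testBit i = true).card =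
      ((range n).filter fun i => N.testBit i).card := by
  rw [← Nat.Iio_eq_range, ← Fin.map_valEmbedding_univ, Finset.filter_map, Finset.card_map]
  rfl

end AutomaticClasses

open AutomaticClasses

/-! ### Block-additive phases (Rudin–Shapiro type) -/

/-- **The crux for block-additive phases, modulo Müllner 2017.** Fix a window length `L` and a local
rule `q ∈ 𝔽₂[y_0, …, y_{L−1}]` with `q(0) = 0`. Assuming `mullner_moebius_automatic`, for every
`ε > 0`, eventually in `n`, every `P ∈ 𝔽₂[x_0..x_{n−1}]` whose values on the cube are the
block-additive digital function `P(bits N) = Σ_{i<n} q(bit_i N, …, bit_{i+L−1} N)` (digits above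
`n − 1` read `0`) satisfies `|Σ_{N<2ⁿ} λ(N)(−1)^{P(bits N)}| ≤ ε 2ⁿ`. These phases (e.g.
Rudin–Shapiro, `q = y_0 y_1`) are bent-type: rank `≍ n`, Walsh spectral norm `2^{Θ(n)}`, outside
every spectral class of the tree. Via `isAutomaticSeq_of_blockAdditive` and
`digitPolyUniformity_automatic`. [cite: Mullner2017, Thm. 1.2] -/
theorem digitPolyUniformity_blockAdditive :
    Literature.NumberTheory.LFunctions.mullner_moebius_automatic → ∀ (L : ℕ) (q : MvPolynomial (Fin L) (ZMod 2)), MvPolynomial.constantCoeff q = 0 → ∀ ε : ℝ, 0 < ε → ∀ᶠ n : ℕ in Filter.atTop, ∀ P : MvPolynomial (Fin n) (ZMod 2), (∀ N : ℕ, N < 2 ^ n → MvPolynomial.eval (fun i : Fin n => if Nat.testBit N i then (1 : ZMod 2) else 0) P = ∑ i ∈ Finset.range n, MvPolynomial.eval (fun j : Fin L => if Nat.testBit N (i + j) then (1 : ZMod 2) else 0) q) → |∑ N ∈ Finset.range (2 ^ n), ((ArithmeticFunction.liouville N : ℤ) : ℝ) * (if MvPolynomial.eval (fun i : Fin n =>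 if Nat.testBit N i then (1 : ZMod 2) else 0) P = 1 then (-1 : ℝ) else 1)| ≤ ε * (2 : ℝ) ^ n := by
  intro hM L q hq ε hε
  -- the local rule as a function of Boolean windows, and the block-additive digital function
  obtain ⟨Q, hQ⟩ : ∃ Q : (Fin L → Bool) → ZMod 2, ∀ w, Q w =
      MvPolynomial.eval (fun j : Fin L => if w j then (1 : ZMod 2) else 0) q := ⟨_, fun _ => rfl⟩
  have hQ0 : Q (fun _ => false) = 0 := by
    rw [hQ]
    simp only [Bool.false_eq_true, if_false]
    rw [MvPolynomial.eval_zero']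
    exact hq
  obtain ⟨c, hc0⟩ : ∃ c : ℕ → ZMod 2, ∀ N, c N =
      ∑ i ∈ range N, Q (fun j : Fin L => N.testBit (i + j)) := ⟨_, fun _ => rfl⟩
  have hc : ∀ N M : ℕ, N < 2 ^ M → c N = ∑ i ∈ range M, Q (fun j : Fin L => N.testBit (i + j)) :=
    fun N M hNM => (hc0 N).trans (sum_window_eq_of_lt Q hQ0 N.lt_two_pow_self hNM)
  obtain ⟨φ, hφ0⟩ : ∃ φ : ℕ → ℝ, ∀ N, φ N = if c N = 1 then -1 else 1 := ⟨_, fun _ => rfl⟩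
  have hφ : IsAutomaticSeq 2 (fun N => (φ N : ℂ)) := by
    have h := isAutomaticSeq_of_blockAdditive L Q hQ0 c hc (fun z => if z = 1 then (-1 : ℂ) else 1)
    convert h using 2 with N
    rw [hφ0]
    split_ifs <;> simp
  filter_upwards [digitPolyUniformity_automatic hM φ hφ ε hε] with n hn P hP
  have hsum : ∑ N ∈ range (2 ^ n), ((ArithmeticFunction.liouville N : ℤ) : ℝ) *
        (if MvPolynomial.eval (fun i : Fin n => if Nat.testBit N i then (1 : ZMod 2) else 0) P = 1
          then (-1 : ℝ) else 1) =
      ∑ N ∈ range (2 ^ n), ((ArithmeticFunction.liouville N : ℤ) : ℝ) * φ N := by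
    refine Finset.sum_congr rfl fun N hN => ?_
    rw [Finset.mem_range] at hN
    rw [hP N hN, hφ0, hc N n hN]
    simp only [hQ]
  rw [hsum]
  exact hn

/-- **Block polynomials exist, with the degree of the local rule.** For every local rule
`q ∈ 𝔽₂[y_0..y_{L−1}]` and every `n` there is `P ∈ 𝔽₂[x_0..x_{n−1}]` of total degree `≤ deg q`
whose cube values are the block-additive function `Σ_{i<n} q(bit_i N, …, bit_{i+L−1} N)`, namely
`P = Σ_{i<n} q(x_i, …, x_{i+L−1})` with `x_t := 0` for `t ≥ n`. In particular the hypothesis class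
of `digitPolyUniformity_blockAdditive` is inside the crux's range `deg ≤ (log₂ n)^A` (`A ≥ 1`) for
all large `n`. [folklore] -/
theorem exists_blockPoly :
    ∀ (L : ℕ) (q : MvPolynomial (Fin L) (ZMod 2)) (n : ℕ), ∃ P : MvPolynomial (Fin n) (ZMod 2), P.totalDegree ≤ q.totalDegree ∧ ∀ N : ℕ, N < 2 ^ n → MvPolynomial.eval (fun i : Fin n => if Nat.testBit N i then (1 : ZMod 2) else 0) P = ∑ i ∈ Finset.range n, MvPolynomial.eval (fun j : Fin L => if Nat.testBit N (i + j) then (1 : ZMod 2) else 0) q := by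
  intro L q n
  classical
  let f : ℕ → Fin L → MvPolynomial (Fin n) (ZMod 2) := fun i j =>
    if h : i + (j : ℕ) < n then MvPolynomial.X ⟨i + j, h⟩ else 0
  have hf : ∀ i j, (f i j).totalDegree ≤ 1 := by
    intro i j
    simp only [f]
    split_ifs
    · exact (MvPolynomial.totalDegree_X _).le
    · simp
  refine ⟨∑ i ∈ range n, MvPolynomial.aeval (f i) q, ?_, ?_⟩
  · refine MvPolynomial.totalDegree_finsetSum_le fun i _ => ?_
    exact Literature.RingTheory.MvPolynomial.totalDegree_aeval_le_of_le_one (f i) (hf i) q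
  · intro N hN
    rw [map_sum]
    refine Finset.sum_congr rfl fun i _ => ?_
    have key := MvPolynomial.aeval_bind₁
      (fun t : Fin n => if Nat.testBit N t then (1 : ZMod 2) else 0) (f i) q
    rw [← MvPolynomial.aeval_eq_bind₁, MvPolynomial.aeval_eq_eval, MvPolynomial.aeval_eq_eval]
      at key
    rw [key]
    have hfun : (fun j : Fin L => MvPolynomial.eval
          (fun t : Fin n => if Nat.testBit N t then (1 : ZMod 2) else 0) (f i j)) =
        fun j : Fin L => if Nat.testBit N (i + j) then (1 : ZMod 2) else 0 := by
      funext j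
      simp only [f]
      split_ifs with h hb hb'
      · rw [MvPolynomial.eval_X]
        exact if_pos hb
      · rw [MvPolynomial.eval_X]
        exact if_neg hb
      · exfalso
        have : N.testBit (i + j) = false :=
          Nat.testBit_eq_false_of_lt (lt_of_lt_of_le hN (Nat.pow_le_pow_right two_pos (by omega)))
        rw [this] at hb'
        exact Bool.false_ne_true hb'
      · simp
    rw [hfun]

/-- **Rudin–Shapiro, modulo Müllner 2017.** Assuming `mullner_moebius_automatic`, for every `ε > 0`,
eventually in `n`, every `P ∈ 𝔽₂[x_0..x_{n−1}]` whose cube values are the Rudin–Shapiro count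
`Σ_{i<n} bit_i(N) bit_{i+1}(N) mod 2` (e.g. `P = Σ_{i<n−1} x_i x_{i+1}`, a full-rank bent-type
quadratic) has `|Σ_{N<2ⁿ} λ(N)(−1)^{P(bits N)}| ≤ ε 2ⁿ`. Instance `q = y_0 y_1` of
`digitPolyUniformity_blockAdditive`. [cite: Mullner2017, Thm. 1.2] -/
theorem digitPolyUniformity_rudinShapiro :
    Literature.NumberTheory.LFunctions.mullner_moebius_automatic → ∀ ε : ℝ, 0 < ε → ∀ᶠ n : ℕ in Filter.atTop, ∀ P : MvPolynomial (Fin n) (ZMod 2), (∀ N : ℕ, N < 2 ^ n → MvPolynomial.eval (fun i : Fin n => if Nat.testBit N i then (1 : ZMod 2) else 0) P = ∑ i ∈ Finset.range n, (if Nat.testBit N i then (1 : ZMod 2) else 0) * (if Nat.testBit N (i + 1) then (1 : ZMod 2) else 0)) → |∑ N ∈ Finset.range (2 ^ n), ((ArithmeticFunction.liouville N : ℤ) : ℝ) * (if MvPolynomial.eval (fun i : Fin n => if Nat.testBit N i then (1 : ZMod 2) else 0) P = 1 then (-1 : ℝ) else 1)| ≤ ε * (2 : ℝ) ^ n := by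
  intro hM ε hε
  have hq : MvPolynomial.constantCoeff
      (MvPolynomial.X (0 : Fin 2) * MvPolynomial.X (1 : Fin 2) : MvPolynomial (Fin 2) (ZMod 2)) = 0 := by
    simp
  filter_upwards [digitPolyUniformity_blockAdditive hM 2 _ hq ε hε] with n hn P hP
  refine hn P fun N hN => ?_
  rw [hP N hN]
  refine Finset.sum_congr rfl fun i _ => ?_
  simp only [map_mul, MvPolynomial.eval_X, Fin.val_zero, Fin.val_one, add_zero]

/-! ### Digit-sum-class phases (symmetric polynomials) -/

/-- **The crux for digit-sum-class weights, modulo Müllner 2017.** Assuming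
`mullner_moebius_automatic`, for every modulus `m ≥ 1`, every `g : ℕ → ℝ` and every `ε > 0`,
eventually in `n`, `|Σ_{N<2ⁿ} λ(N) g(s₂(N) mod m)| ≤ ε 2ⁿ`, where `s₂(N)` is the number of set
binary digits of `N` (counted among the positions `< n`). Via `isAutomaticSeq_of_digitWeight` and
`digitPolyUniformity_automatic`. [cite: Mullner2017, Thm. 1.2] -/
theorem digitPolyUniformity_digitSum :
    Literature.NumberTheory.LFunctions.mullner_moebius_automatic → ∀ m : ℕ, 0 < m → ∀ g : ℕ → ℝ, ∀ ε : ℝ, 0 < ε → ∀ᶠ n : ℕ in Filter.atTop, |∑ N ∈ Finset.range (2 ^ n), ((ArithmeticFunction.liouville N : ℤ) : ℝ) * g (((Finset.range n).filter fun i => N.testBit i).card % m)| ≤ ε * (2 : ℝ) ^ n := by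
  intro hM m hm g ε hε
  set w : ℕ → ℕ := fun N => ((range N).filter fun i => N.testBit i).card with hw_def
  have hw : ∀ N M : ℕ, N < 2 ^ M → w N = ((range M).filter fun i => N.testBit i).card :=
    fun N M hNM => card_filter_testBit_eq_of_lt N.lt_two_pow_self hNM
  have hφ : IsAutomaticSeq 2 (fun N => ((g (w N % m) : ℝ) : ℂ)) :=
    isAutomaticSeq_of_digitWeight m hm w hw (fun s => (g s : ℂ))
  filter_upwards [digitPolyUniformity_automatic hM (fun N => g (w N % m)) hφ ε hε] with n hn
  have hsum : ∑ N ∈ range (2 ^ n), ((ArithmeticFunction.liouville N : ℤ) : ℝ) *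
        g (((range n).filter fun i => N.testBit i).card % m) =
      ∑ N ∈ range (2 ^ n), ((ArithmeticFunction.liouville N : ℤ) : ℝ) * g (w N % m) := by
    refine Finset.sum_congr rfl fun N hN => ?_
    rw [Finset.mem_range] at hN
    rw [hw N n hN]
  rw [hsum]
  exact hn

/-- `C(w, k) mod 2` depends only on `w mod 2^t` once `k < 2^t` (iterate `choose_mod_two_periodic`).
[folklore] -/
theorem choose_mod_two_eq_choose_mod (t k : ℕ) (hk : k < 2 ^ t) (w : ℕ) :
    ((w.choose k : ℕ) : ZMod 2) = (((w % 2 ^ t).choose k : ℕ) : ZMod 2) := by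
  have key : ∀ a r : ℕ, (((r + 2 ^ t * a).choose k : ℕ) : ZMod 2) = ((r.choose k : ℕ) : ZMod 2) := by
    intro a r
    induction a with
    | zero => simp
    | succ a ih =>
      rw [show r + 2 ^ t * (a + 1) = (r + 2 ^ t * a) + 2 ^ t by ring,
        choose_mod_two_periodic t k _ hk, ih]
  conv_lhs => rw [← Nat.mod_add_div w (2 ^ t)]
  exact key _ _

/-- **The crux for the elementary symmetric polynomials, modulo Müllner 2017.** Assuming
`mullner_moebius_automatic`, for every fixed `k` and every `ε > 0`, eventually in `n`, the phase of
`e_k(x_0, …, x_{n−1}) = Σ_{|S| = k} Π_{i ∈ S} x_i` (for `k = 2` the full-rank quadratic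
`Σ_{i<j} x_i x_j`) satisfies `|Σ_{N<2ⁿ} λ(N)(−1)^{e_k(bits N)}| ≤ ε 2ⁿ`: `e_k(bits N) = C(s₂(N), k)`
(`eval_esymm_indicator`) is a function of `s₂(N) mod 2^k` (Lucas: `choose_mod_two_periodic`), so
`digitPolyUniformity_digitSum` applies. [cite: Mullner2017, Thm. 1.2] -/
theorem digitPolyUniformity_esymm :
    Literature.NumberTheory.LFunctions.mullner_moebius_automatic → ∀ k : ℕ, ∀ ε : ℝ, 0 < ε → ∀ᶠ n : ℕ in Filter.atTop, |∑ N ∈ Finset.range (2 ^ n), ((ArithmeticFunction.liouville N : ℤ) : ℝ) * (if MvPolynomial.eval (fun i : Fin n => if Nat.testBit N i then (1 : ZMod 2) else 0) (MvPolynomial.esymm (Fin n) (ZMod 2) k) = 1 then (-1 : ℝ) else 1)| ≤ ε * (2 : ℝ) ^ n := by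
  intro hM k ε hε
  obtain ⟨g, hg⟩ : ∃ g : ℕ → ℝ, ∀ s, g s = if ((s.choose k : ℕ) : ZMod 2) = 1 then -1 else 1 :=
    ⟨_, fun _ => rfl⟩
  filter_upwards [digitPolyUniformity_digitSum hM (2 ^ k) (by positivity) g ε hε] with n hn
  have hsum : ∑ N ∈ range (2 ^ n), ((ArithmeticFunction.liouville N : ℤ) : ℝ) *
        (if MvPolynomial.eval (fun i : Fin n => if Nat.testBit N i then (1 : ZMod 2) else 0)
            (MvPolynomial.esymm (Fin n) (ZMod 2) k) = 1 then (-1 : ℝ) else 1) =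
      ∑ N ∈ range (2 ^ n), ((ArithmeticFunction.liouville N : ℤ) : ℝ) *
        g (((range n).filter fun i => N.testBit i).card % 2 ^ k) := by
    refine Finset.sum_congr rfl fun N _ => ?_
    rw [eval_esymm_indicator n k (fun i : Fin n => N.testBit i), card_univ_filter_testBit,
      hg, ← choose_mod_two_eq_choose_mod k k k.lt_two_pow_self]
  rw [hsum]
  exact hn

end Summit.QuantumAdvantage.QuantumAdvantage.Theorems.MobiusLadder

end
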